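import Summits.QuantumFields.YangMills.Theorems.UnitScaleTiltHalvingHSiteTopKnit
import HarnessLib

/-!
# `hP1room` PROGRAMME (LEAD-H «H = hSupUρ3 ⟸ hSiteRows», (K-site) gap (G2)): ★★ THE READS OF THE COMPOSITE-GAUGED ITERATE ON THE TOP CUBE — near-`1` from Theorem 4's
# chart at level `k − 1` and `SU(2)`-valuedness, for every torus bond whose window representative lies in `□_k` (the `hW₁ hWu hdet` inputs of (K-DE) ✓p651548)

Route `UnitScaleTilt`, crux K1 child «MinimiserStabilityRegPr» (stmt-QuantumFields-19200), registered stub `stub_halvingStep` (`BirthV10`).  Cell `ym3-torus` (HUMAN RULING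
D-0037: YM₃ on T³ is ladder rung R3 — NOT d = 4, NOT a mass gap, NOT the Clay problem), width seat `ym-ust-20520-w3` gen 6.  `--supports stmt-QuantumFields-19200 --as helper`;
THEOREMS ONLY (0 `def`, 0 `sorry`); count-neutral; nothing here claims `core′`, `hP1room(ρ3)`, `hSupU(ρ3)`, the stub, the crux or the gap.

WHAT.  (K-DE) ✓p651548 `P1FlatCoreTopBlocksAtMember.topTarget_of_reads` ∕ `hTop…_of_reads` read the charted iterate `W₁` on a territory `T` of `k`-blocks through three rows:
`hW₁ : ‖W₁ b − 1‖ ≤ s₀`, `hWu : W₁ b ∈ U(2)`, `hdet : det W₁ b = 1` for the bonds `b` with both `k`-blocks in `T`.  At the member, `W₁ := (U♯)^g` for the COMPOSITE gauge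
`g := (u₁ ∘ rep)⁻¹·(toUnits ∘ suIncl ∘ gJ)` (✓p645686's letter).  ★★ `topReads_of_datum`: for EVERY torus bond `b` whose window representative `rep b.src := lift x₀ + rel x₀ b.src`
lies in N05's top cube `□_k = cube L a M′ ρ′ k k`:  `‖(U♯)^g b − 1‖ ≤ e^{c₁} − 1` (from the chart-with-size row `hchartTop` of ✓p647313 — `W = e^{iηA}`, `η‖A‖ ≤ c₁` on `□_k`,
✓p652002 `hchartTop_of_hdat`) AND `(U♯)^g b ∈ U(2)`, `det = 1` (the gauge is special unitary: ✓p645686 `hg_of_datum`; the field is: ✓`su2_toUnits`).  MECHANISM: `b = ⟨0 + z, ν⟩`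
with `z := rep b.src` (✓`cover_lift_add_rel`), `z + e_ν ∈ □_{k−1} ⊆ □₀` (lit ✓`add_mem_cube_of_mem_succ`, ✓`cube_anti`), the descent identity on `□₀` ✓p655738
`gaugeActT_descent_eq_of_mgauge_cube`, then ✓p645686 `norm_cfgExp_sub_one_le`.  So the (G1) pen only has to choose `T` with «`π_k s ∈ T ⇒ rep s ∈ □_k`» and the three
(K-DE) rows follow at `s₀ := e^{c₁} − 1` (`≤ η·c′` by ✓p647313's `hc₁`).  HONEST SCOPE: identities + one triangle; nothing of (K-DE), Prop. 3∕5, Theorem 4 or the stub is proved here.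

References: T. Bałaban, CMP **99** (1985) 75–102 [Balaban1985RegularSpaces] ((1.36) p.82, (1.68)–(1.69) p.88, (1.131) p.99); CMP **102** (1985) 277–309 [Balaban1985Variational] ((152) p.301).
-/

set_option autoImplicit false

noncomputable section

open scoped BigOperators Matrix.Norms.L2Operator
open NormedSpace
open Complex (I)

namespace Summit.QuantumFields.YangMills.Theorems.HalvingHSiteTopReads

open Literature.MathematicalPhysics.QuantumFieldTheory.Balaban1983to89
open Literature.MathematicalPhysics.QuantumFieldTheory.Balaban1983to89.T3ContinuumYM3Torus
open B5Eq118OneStroke (iterBlockOf)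
open B7Prop1Explicit renaming Site → LSite
open B7Prop1Explicit (e)
open B7Eq92Concrete (mgauge)
open B8Eq131Cubes (cube gs cube_anti)
open B8Eq131CubesAdmissible (add_mem_cube_of_mem_succ)
open B8Eq184Proof (cfgExp)
open B10Eq27TorusAxialLog (transl rel pull unitsField toUField suIncl gaugeActT gaugeActT_apply)
open B15Eq112TorusCover (lift cover)
open P1FlatCoreCubeInclusion (transl_zero_eq_cover cover_lift_add_rel)
open HalvingP1FlatCoreSupplierGaugeDescent (hg_of_datum norm_cfgExp_sub_one_le)
open HalvingCompetitorMapFibre (su2_toUnits)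
open HalvingCompetitorMapFramesSU2 (su2_pred_mul su2_pred_inv)
open HalvingHSiteTopKnit (gaugeActT_descent_eq_of_mgauge_cube)

variable {F : T3Family} {n K : ℕ}

/-- ★★ **THE READS OF THE COMPOSITE-GAUGED ITERATE ON THE TOP CUBE** — see the module docstring: for every torus bond whose window representative lies in `□_k`,
`‖(U♯)^g b − 1‖ ≤ e^{c₁} − 1`, `(U♯)^g b ∈ U(2)` and `det (U♯)^g b = 1` (the `hW₁ hWu hdet` letters of (K-DE) ✓p651548 at `s₀ := e^{c₁} − 1`).
[cite: Balaban1985RegularSpaces, (1.36) p.82, (1.68)-(1.69) p.88, (1.131) p.99; Balaban1985Variational, (152) p.301] -/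
theorem topReads_of_datum (hnK : n < K) (x₀ : Site (F.P K) 0) {a : LSite (F.P K).d} {M' ρ' : ℕ} (hρ'1 : 1 ≤ ρ')
    (ha : ∀ ν, a ν ≤ ((iterBlockOf (K - n) x₀ ν).val : ℤ) ∧ ((iterBlockOf (K - n) x₀ ν).val : ℤ) ≤ a ν + M' - 1)
    (hroomW : 2 * ((F.P K).L ^ (K - n) * (M' + 1) + ρ' * gs (F.P K).L (K - n)) ≤ (F.P K).sitesPerDir 0)
    (U : GaugeField (F.P K) 0 (Matrix.specialUnitaryGroup (Fin 2) ℂ)) (gJ : GaugeTransf (F.P K) 0 (Matrix.specialUnitaryGroup (Fin 2) ℂ))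
    -- Theorem 4's datum `(u₁, W, A)`: `u₁` special unitary, `W^{u₁} = U′ := pull (U^{gJ})♯ 0`, the chart with size on the top cube (✓p647313's `hchartTop`)
    {u₁ : LSite (F.P K).d → (Matrix (Fin 2) (Fin 2) ℂ)ˣ} {W : LSite (F.P K).d → Fin (F.P K).d → (Matrix (Fin 2) (Fin 2) ℂ)ˣ}
    {A : LSite (F.P K).d → Fin (F.P K).d → Matrix (Fin 2) (Fin 2) ℂ}
    (hu₁SU : ∀ z, ((u₁ z : (Matrix (Fin 2) (Fin 2) ℂ)ˣ) : Matrix (Fin 2) (Fin 2) ℂ) ∈ Matrix.specialUnitaryGroup (Fin 2) ℂ)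
    (hW : mgauge (1 : LSite (F.P K).d → Fin (F.P K).d → (Matrix (Fin 2) (Fin 2) ℂ)ˣ) u₁ W = pull (unitsField (toUField (GaugeField.gaugeAct gJ U))) 0)
    {η c₁ : ℝ} (hη : 0 ≤ η)
    (hchartTop : ∀ z ∈ cube (F.P K).L a M' ρ' (K - n) (K - n), ∀ ν : Fin (F.P K).d, W z ν = cfgExp η A z ν ∧ η * ‖A z ν‖ ≤ c₁) :
    ∀ b : PBond (F.P K) 0, lift (F.P K) x₀ + rel x₀ b.src ∈ cube (F.P K).L a M' ρ' (K - n) (K - n) →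
      ‖((gaugeActT (fun s => (u₁ (lift (F.P K) x₀ + rel x₀ s))⁻¹ * Unitary.toUnits (suIncl (gJ s)) : GaugeTransf (F.P K) 0 (Matrix (Fin 2) (Fin 2) ℂ)ˣ)
          (unitsField (toUField U)) b : (Matrix (Fin 2) (Fin 2) ℂ)ˣ) : Matrix (Fin 2) (Fin 2) ℂ) - 1‖ ≤ Real.exp c₁ - 1 ∧
      ((gaugeActT (fun s => (u₁ (lift (F.P K) x₀ + rel x₀ s))⁻¹ * Unitary.toUnits (suIncl (gJ s)) : GaugeTransf (F.P K) 0 (Matrix (Fin 2) (Fin 2) ℂ)ˣ)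
          (unitsField (toUField U)) b : (Matrix (Fin 2) (Fin 2) ℂ)ˣ) : Matrix (Fin 2) (Fin 2) ℂ) ∈ Matrix.unitaryGroup (Fin 2) ℂ ∧
      ((gaugeActT (fun s => (u₁ (lift (F.P K) x₀ + rel x₀ s))⁻¹ * Unitary.toUnits (suIncl (gJ s)) : GaugeTransf (F.P K) 0 (Matrix (Fin 2) (Fin 2) ℂ)ˣ)
          (unitsField (toUField U)) b : (Matrix (Fin 2) (Fin 2) ℂ)ˣ) : Matrix (Fin 2) (Fin 2) ℂ).det = 1 := by
  intro b hzk
  -- the representative `z` of the source and its bond `⟨0 + z, ν⟩ = b`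
  set z : LSite (F.P K).d := lift (F.P K) x₀ + rel x₀ b.src with hzdef
  have hsrc : transl (0 : Site (F.P K) 0) z = b.src := by rw [transl_zero_eq_cover, hzdef, cover_lift_add_rel]
  have hb : b = ⟨transl (0 : Site (F.P K) 0) z, b.dir⟩ := by rw [hsrc]
  -- both ends of the bond lie in `□₀`: `z ∈ □_k ⊆ □₀`, `z + e_ν ∈ □_{k−1} ⊆ □₀`
  have hz0 : z ∈ cube (F.P K).L a M' ρ' (K - n) 0 := cube_anti (Nat.zero_le _) le_rfl hzk
  have hkk : K - n = (K - n - 1) + 1 := by omega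
  have hzν1 : z + e b.dir ∈ cube (F.P K).L a M' ρ' (K - n) (K - n - 1) := by
    refine add_mem_cube_of_mem_succ (by omega) (hkk ▸ hzk) fun i => ?_
    rw [B7Prop1Explicit.e_apply]
    have h1 : (1 : ℤ) ≤ ((ρ' * (F.P K).L ^ (K - n - 1) : ℕ) : ℤ) := by
      have : 1 ≤ ρ' * (F.P K).L ^ (K - n - 1) := Nat.one_le_iff_ne_zero.2 (Nat.mul_ne_zero (by omega) (pow_ne_zero _ (F.P K).L_pos.ne'))
      exact_mod_cast this
    split_ifs <;> simp only [abs_one, abs_zero] <;> linarith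
  have hzν : z + e b.dir ∈ cube (F.P K).L a M' ρ' (K - n) 0 := cube_anti (Nat.zero_le _) (by omega) hzν1
  -- the descent identity on `□₀` and the chart with size on `□_k`
  have hid := gaugeActT_descent_eq_of_mgauge_cube x₀ ha hroomW U gJ u₁ W hW hz0 b.dir hzν
  obtain ⟨hWz, hAz⟩ := hchartTop z hzk b.dir
  refine ⟨?_, ?_⟩
  · rw [hb, hid, hWz]
    exact norm_cfgExp_sub_one_le hη z b.dir hAz
  · -- special unitarity of the gauge copy: `g(b₋)·U♯(b)·g(b₊)⁻¹ ∈ SU(2)`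
    have hg := hg_of_datum x₀ gJ u₁ hu₁SU
    rw [gaugeActT_apply]
    exact su2_pred_mul _ _ (su2_pred_mul _ _ (Matrix.mem_specialUnitaryGroup_iff.1 (hg b.src)) (su2_toUnits U b))
      (su2_pred_inv _ (Matrix.mem_specialUnitaryGroup_iff.1 (hg b.tgt)))

end Summit.QuantumFields.YangMills.Theorems.HalvingHSiteTopReads

end
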